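import Summits.AtomisticToContinuum.Crystallization.Theorems.ChessboardParticlePlanesPeriodicWindowsHcPhiTaylor

/-!
# Crux `PeriodicWindows` (stmt-AtomisticToContinuum-3240), line `dense-laminar-hull` — `hc_quadTerm`: the termwise quadratic bound of the
# 3-fold symmetrised layer sum (input of the crude far-layer bound, the `k ≥ 11` part of CERT E2; lead c12)

For one lattice term `F(x) = (1/12)x⁻⁶ − (1/6)x⁻³` (`x = H² + ‖u‖²`) and the three symmetrised increments `t_k = ‖u + T^k ξ‖² − ‖u‖²`
(first moment `Σ t_k = 3‖ξ‖²`, second moment `Σ (t_k − ‖ξ‖²)² = 6‖u‖²‖ξ‖²`, `hc_rot3` / `hc_rot3_cubic`), the order-1 Taylor bound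
`hc_phiTaylor` gives `|Σ_k (F(x + t_k) − F(x))| ≤ 3|F′(x)| ‖ξ‖² + K₂(m) (6‖u‖²‖ξ‖² + 3‖ξ‖⁴)`, `K₂(m) = (7/2)m⁻⁸ + 2m⁻⁵`, whenever
`x, x + t_k ≥ m > 0`: the linear parts add up to `F′(x)·3‖ξ‖²` and `Σ t_k² = 6‖u‖²‖ξ‖² + 3‖ξ‖⁴`. Pure algebra. [folklore]
-/

noncomputable section

namespace Summit.AtomisticToContinuum.Crystallization.Theorems.PeriodicWindowsDenseLaminarHull

open Literature.MathematicalPhysics.StatisticalMechanics Filter Metric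
open scoped BigOperators

/-- **`hc_quadTerm`** (see the module docstring; `R = ‖ξ‖²`, `U = ‖u‖²`). [folklore] -/
theorem hc_quadTerm : ∀ x m R U t₀ t₁ t₂ : ℝ, 0 < m → m ≤ x → m ≤ x + t₀ → m ≤ x + t₁ → m ≤ x + t₂ → 0 ≤ R → 0 ≤ U →
    t₀ + t₁ + t₂ = 3 * R → (t₀ - R) ^ 2 + (t₁ - R) ^ 2 + (t₂ - R) ^ 2 = 6 * U * R →
    |(((1 / 12 : ℝ) * ((x + t₀)⁻¹) ^ 6 - (1 / 6) * ((x + t₀)⁻¹) ^ 3) - ((1 / 12) * (x⁻¹) ^ 6 - (1 / 6) * (x⁻¹) ^ 3)) +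
      (((1 / 12 : ℝ) * ((x + t₁)⁻¹) ^ 6 - (1 / 6) * ((x + t₁)⁻¹) ^ 3) - ((1 / 12) * (x⁻¹) ^ 6 - (1 / 6) * (x⁻¹) ^ 3)) +
      (((1 / 12 : ℝ) * ((x + t₂)⁻¹) ^ 6 - (1 / 6) * ((x + t₂)⁻¹) ^ 3) - ((1 / 12) * (x⁻¹) ^ 6 - (1 / 6) * (x⁻¹) ^ 3))| ≤
      3 * |-(1 / 2) * (x⁻¹) ^ 7 + (1 / 2) * (x⁻¹) ^ 4| * R + ((7 / 2) * (m⁻¹) ^ 8 + 2 * (m⁻¹) ^ 5) * (6 * U * R + 3 * R ^ 2) := by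
  intro x m R U t₀ t₁ t₂ hm hx h₀ h₁ h₂ _hR _hU hsum hsq
  obtain ⟨-, htaylor⟩ := hc_phiTaylor
  -- the three order-1 remainders
  have r₀ := (htaylor x (x + t₀) m hm hx h₀).1
  have r₁ := (htaylor x (x + t₁) m hm hx h₁).1
  have r₂ := (htaylor x (x + t₂) m hm hx h₂).1
  simp only [add_sub_cancel_left] at r₀ r₁ r₂
  set D := -(1 / 2) * (x⁻¹) ^ 7 + (1 / 2) * (x⁻¹) ^ 4 with hD
  set K := (7 / 2) * (m⁻¹) ^ 8 + 2 * (m⁻¹) ^ 5 with hK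
  set F : ℝ → ℝ := fun y => (1 / 12) * (y⁻¹) ^ 6 - (1 / 6) * (y⁻¹) ^ 3 with hF
  have hK0 : 0 ≤ K := by rw [hK]; positivity
  -- the sum of squares of the increments
  have hsq' : t₀ ^ 2 + t₁ ^ 2 + t₂ ^ 2 = 6 * U * R + 3 * R ^ 2 := by nlinarith [hsum, hsq]
  -- rewrite the three differences as linear part + remainder
  have e : (F (x + t₀) - F x) + (F (x + t₁) - F x) + (F (x + t₂) - F x) =
      D * (3 * R) + ((F (x + t₀) - F x - D * t₀) + (F (x + t₁) - F x - D * t₁) + (F (x + t₂) - F x - D * t₂)) := by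
    rw [← hsum]; ring
  have hmain : |(F (x + t₀) - F x) + (F (x + t₁) - F x) + (F (x + t₂) - F x)| ≤ 3 * |D| * R + K * (6 * U * R + 3 * R ^ 2) := by
    rw [e, ← hsq']
    calc |D * (3 * R) + ((F (x + t₀) - F x - D * t₀) + (F (x + t₁) - F x - D * t₁) + (F (x + t₂) - F x - D * t₂))|
        ≤ |D * (3 * R)| + |(F (x + t₀) - F x - D * t₀) + (F (x + t₁) - F x - D * t₁) + (F (x + t₂) - F x - D * t₂)| :=
          abs_add_le _ _
      _ ≤ |D * (3 * R)| + (|F (x + t₀) - F x - D * t₀| + |F (x + t₁) - F x - D * t₁| + |F (x + t₂) - F x - D * t₂|) := by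
          gcongr
          exact (abs_add_le _ _).trans (by gcongr; exact abs_add_le _ _)
      _ ≤ 3 * |D| * R + (K * t₀ ^ 2 + K * t₁ ^ 2 + K * t₂ ^ 2) := by
          have hDR : |D * (3 * R)| = 3 * |D| * R := by
            rw [abs_mul, abs_of_nonneg (by positivity : (0 : ℝ) ≤ 3 * R)]; ring
          rw [hDR]
          have q₀ : |F (x + t₀) - F x - D * t₀| ≤ K * t₀ ^ 2 := by simpa [hF, hD, hK] using r₀
          have q₁ : |F (x + t₁) - F x - D * t₁| ≤ K * t₁ ^ 2 := by simpa [hF, hD, hK] using r₁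
          have q₂ : |F (x + t₂) - F x - D * t₂| ≤ K * t₂ ^ 2 := by simpa [hF, hD, hK] using r₂
          linarith
      _ = 3 * |D| * R + K * (t₀ ^ 2 + t₁ ^ 2 + t₂ ^ 2) := by ring
  simpa [hF, hD, hK] using hmain

end Summit.AtomisticToContinuum.Crystallization.Theorems.PeriodicWindowsDenseLaminarHull

end
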